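import Literature.Probability.Percolation.SmirnovSeparatingData
import HarnessLib

/-!
# Smirnov families from separating data, generic in the functional (stub `stub_familiesOfData`)

Helper file for the crux `Target` (stmt-CriticalPhenomena-6431) of route `CardyFlipRusso`
(sub-problem `CardyFormulaZ2`), line `Sketch`: the registered stub `stub_familiesOfData`.

Let `R = (Ω; a', b', c', d')` be a conformal rectangle, `abc` a triangle and `p : ℝ → ℝ` any
functional (`p δ` = a crossing probability of `R` at mesh `δ`). Suppose two systems of discrete
separating data `(S⁻, f⁻)`, `(S⁺, f⁺)` for `R` with the root of unity `triangleTurn a b c`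
(`IsSeparatingData`: `[0, 1]`-valued functions `f_δⁱ` on finite sets `S_δ`, dense in `closure Ω`,
approximately equicontinuous, discrete Cauchy estimate, boundary behaviour) sandwich `p`:
`f⁻_δ¹(z⁻_δ) - e(δ) ≤ p(δ) ≤ f⁺_δ¹(z⁺_δ) + e(δ)` eventually as `δ → 0⁺`, at points
`z^∓_δ ∈ S^∓_δ ∩ Ω` tending to `d'`, with `e(δ) → 0`. Then `p` is Smirnov-sandwiched: there are
`δ₀ > 0` and two Smirnov separating families `g⁻`, `g⁺` (`IsSmirnovFamily`) with
`g⁻_δ¹(z⁻_δ) - e'(δ) ≤ p(δ) ≤ g⁺_δ¹(z⁺_δ) + e'(δ)` on `(0, δ₀)`, `e'(δ) → 0`.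

This is verbatim the tree's PROVED passage (D) ⇐ (D′)
`Literature.Probability.Percolation.smirnov_exists_separatingFamilies_of_separatingData`
(`SmirnovSeparatingData.lean`, §Assembly) with the crossing probability `triDomainCrossingProb R δ`
abstracted to `p δ` and for one triangle `abc` instead of a Carleson datum (nothing about a
Carleson map is used there): the families are the McShane interpolants `dataFamily S f ε` of the
data (`IsSeparatingData.isSmirnovFamily`, Bollobás–Riordan's Claims 22 and 23), and the sandwich
is transferred by `f ≤ g ≤ f + o(1)` on `S_δ` (`dataFamily_approx`, `mcShane.le_self`).

## References

* B. Bollobás, O. Riordan, *Percolation*, Cambridge University Press (2006), Ch. 7, §7.2.6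
  pp. 196–203 ((32)–(34), Claims 22–23, (39)–(40), proof of Thm. 2).
* S. Smirnov, *Critical percolation in the plane: conformal invariance, Cardy's formula, scaling
  limits*, C. R. Acad. Sci. Paris Sér. I 333 (2001) 239–244, Thm. 1.
-/

noncomputable section

namespace Summit.CriticalPhenomena.CardyFormulaZ2.Theorems.CardyFlipRussoTarget

open Filter Set Metric
open scoped Topology
open Literature.Probability.RandomPlanarGeometry
open Literature.Probability.Percolation

/-- **Smirnov separating families from discrete separating data, generic in the sandwiched
functional** (stub `stub_familiesOfData` of line `Sketch` for the crux `Target`,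
stmt-CriticalPhenomena-6431). For a conformal rectangle `R = (Ω; a', b', c', d')`, a triangle
`abc` and any `p : ℝ → ℝ`: if two systems of separating data `(S⁻, f⁻)`, `(S⁺, f⁺)` for `R` with
root of unity `triangleTurn a b c` sandwich `p` — `f⁻_δ¹(z⁻_δ) - e(δ) ≤ p(δ) ≤ f⁺_δ¹(z⁺_δ) + e(δ)`
eventually as `δ → 0⁺`, `z^∓_δ ∈ S^∓_δ ∩ Ω`, `z^∓_δ → d'`, `e(δ) → 0` — then there are `δ₀ > 0`
and two Smirnov separating families `g⁻`, `g⁺` (`IsSmirnovFamily R a b c δ₀`) with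
`g⁻_δ¹(z⁻_δ) - e'(δ) ≤ p(δ) ≤ g⁺_δ¹(z⁺_δ) + e'(δ)` for `0 < δ < δ₀`, `e'(δ) → 0`. Proof
(Bollobás–Riordan 2006, Ch. 7, §7.2.6 pp. 196–203, with `P_δ` replaced by `p(δ)`): take the
McShane interpolants `g^∓ = dataFamily S^∓ f^∓ ε^∓` (`ε^∓(δ) → 0` the density scale of the data),
which are Smirnov families by `IsSeparatingData.isSmirnovFamily` (Claims 22–23, pp. 197–201);
extract a horizon `δ₀` from the eventual memberships and the eventual sandwich; and put
`e' = e + (g⁻_δ¹(z⁻_δ) - f⁻_δ¹(z⁻_δ))`, which tends to `0` by `f ≤ g ≤ f + o(1)` on `S_δ`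
(`dataFamily_approx`, (39) p. 200), so that `g⁻(z⁻) - e' = f⁻(z⁻) - e ≤ p` and
`p ≤ f⁺(z⁺) + e ≤ g⁺(z⁺) + e'` by `f ≤ g` on `S_δ` (`mcShane.le_self`).
[cite: BollobasRiordan2006, Ch. 7 §7.2.6 pp. 196–203] -/
theorem stub_familiesOfData : ∀ (R : ConformalRectangle) (a b c : ℂ) (p : ℝ → ℝ),
    (∃ (Sm Sp : ℝ → Finset ℂ) (fm fp : ℝ → Fin 3 → ℂ → ℝ),
      IsSeparatingData R (triangleTurn a b c) Sm fm ∧ IsSeparatingData R (triangleTurn a b c) Sp fp ∧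
      ∃ (zm zp : ℝ → ℂ) (e : ℝ → ℝ),
        (∀ᶠ δ in 𝓝[>] (0 : ℝ), zm δ ∈ Sm δ ∧ zm δ ∈ R.carrier ∧ zp δ ∈ Sp δ ∧ zp δ ∈ R.carrier) ∧
        Tendsto zm (𝓝[>] 0) (𝓝 (R.pt 3)) ∧ Tendsto zp (𝓝[>] 0) (𝓝 (R.pt 3)) ∧
        Tendsto e (𝓝[>] 0) (𝓝 0) ∧
        ∀ᶠ δ in 𝓝[>] (0 : ℝ), fm δ 1 (zm δ) - e δ ≤ p δ ∧ p δ ≤ fp δ 1 (zp δ) + e δ) →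
    ∃ δ₀ > (0 : ℝ), ∃ gm gp : ℝ → Fin 3 → ℂ → ℝ,
      IsSmirnovFamily R a b c δ₀ gm ∧ IsSmirnovFamily R a b c δ₀ gp ∧
      ∃ (zm zp : ℝ → ℂ) (e : ℝ → ℝ),
        (∀ δ ∈ Set.Ioo 0 δ₀, zm δ ∈ R.carrier ∧ zp δ ∈ R.carrier) ∧
        Tendsto zm (𝓝[>] 0) (𝓝 (R.pt 3)) ∧ Tendsto zp (𝓝[>] 0) (𝓝 (R.pt 3)) ∧
        Tendsto e (𝓝[>] 0) (𝓝 0) ∧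
        ∀ δ ∈ Set.Ioo 0 δ₀, gm δ 1 (zm δ) - e δ ≤ p δ ∧ p δ ≤ gp δ 1 (zp δ) + e δ := by
  intro R a b c p h
  obtain ⟨Sm, Sp, fm, fp, hDm, hDp, zm, zp, e, hmem, hzm, hzp, he, hsand⟩ := h
  obtain ⟨εm, hεm, hdensem⟩ := hDm.dense
  obtain ⟨εp, hεp, hdensep⟩ := hDp.dense
  set gm : ℝ → Fin 3 → ℂ → ℝ := dataFamily Sm fm εm with hgm
  set gp : ℝ → Fin 3 → ℂ → ℝ := dataFamily Sp fp εp
  -- the horizon `δ₀`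
  obtain ⟨δ₀, hδ₀, hgood⟩ := exists_forall_Ioo_of_eventually (hmem.and hsand)
  -- the error `e' = e + (g⁻(z⁻) - f⁻(z⁻))`
  set e' : ℝ → ℝ := fun δ => e δ + (gm δ 1 (zm δ) - fm δ 1 (zm δ)) with he'_def
  have hdiff : Tendsto (fun δ => gm δ 1 (zm δ) - fm δ 1 (zm δ)) (𝓝[>] 0) (𝓝 0) := by
    rw [Metric.tendsto_nhdsWithin_nhds]
    intro η hη
    obtain ⟨δ₁, hδ₁, h₁⟩ := exists_forall_Ioo_of_eventually
      ((dataFamily_approx hDm hεm (half_pos hη)).and hmem)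
    refine ⟨δ₁, hδ₁, fun {δ} hδpos hδd => ?_⟩
    have hδ : δ ∈ Ioo 0 δ₁ := by
      refine ⟨hδpos, ?_⟩
      rw [Real.dist_eq, sub_zero, abs_of_pos (mem_Ioi.1 hδpos)] at hδd
      exact hδd
    obtain ⟨happ, hm⟩ := h₁ δ hδ
    have h := happ 1 (zm δ) hm.1
    rw [Real.dist_0_eq_abs, abs_lt]
    constructor <;> simp only [hgm] <;> linarith [h.1, h.2]
  have he' : Tendsto e' (𝓝[>] 0) (𝓝 0) := by
    simpa using he.add hdiff
  refine ⟨δ₀, hδ₀, gm, gp, hDm.isSmirnovFamily hεm hdensem δ₀, hDp.isSmirnovFamily hεp hdensep δ₀,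
    zm, zp, e', fun δ hδ => ⟨(hgood δ hδ).1.2.1, (hgood δ hδ).1.2.2.2⟩, hzm, hzp, he',
    fun δ hδ => ?_⟩
  obtain ⟨⟨hzm₁, -, hzp₁, -⟩, hlow, hup⟩ := hgood δ hδ
  constructor
  · -- `g⁻(z⁻) - e' = f⁻(z⁻) - e ≤ p`
    simp only [he'_def]
    linarith
  · -- `p ≤ f⁺(z⁺) + e ≤ g⁺(z⁺) + e ≤ g⁺(z⁺) + e'`
    have h1 : fp δ 1 (zp δ) ≤ gp δ 1 (zp δ) := mcShane.le_self hzp₁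
    have h2 : fm δ 1 (zm δ) ≤ gm δ 1 (zm δ) := mcShane.le_self hzm₁
    simp only [he'_def]
    linarith

end Summit.CriticalPhenomena.CardyFormulaZ2.Theorems.CardyFlipRussoTarget

end
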